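import Summits.AtomisticToContinuum.Crystallization.Theorems.ThreeConeCertificateSlackRigidityPricedFloorsIncrIdent1
import Summits.AtomisticToContinuum.Crystallization.Theorems.ThreeConeCertificateSlackRigidityPricedFloorsContinuity2
import Summits.AtomisticToContinuum.Crystallization.Theorems.ThreeConeCertificateSlackRigidityPricedFloorsMeasurability
import Summits.AtomisticToContinuum.Crystallization.Theorems.ThreeConeCertificateSlackRigidityPricedFloorsContinuity
import HarnessLib

/-!
# `SlackRigidity` (stmt-AtomisticToContinuum-11960), line `priced-floors-palm-exactification`, stub S3
# (`stub_layeredMeanSelection`), package (II): increment functionals, part 3 — presentation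
# invariance, continuity and bounds of the data functionals

Lead c19, worker package (II), part 3.  For the inline data functionals of parts 1–2 (`LE e m`,
`AE n e`, `BE n e`, `VE n e`, `DE e`, `DtE n e`; data `e = (T, a, s, z)`):

* `lms_functionals_rel` (registered) — INVARIANCE UNDER THE DATA RELATION `REL e e'` (same spacing;
  heights equal or reversed `m ↦ −z(−m)`; word equal up to a global sign, resp. reversed
  `m ↦ ±s(−m−1)`): all five window functionals take the same value on `e` and `e'`.  The layer
  energy uses label DIFFERENCES and `Φ` is even in the offset (`layerInteraction_neg_offset`) and in
  the height (`Continuity.layerInteraction_neg_height`), so `LE e' m = LE e m` resp. `LE e' m = LE e (−m)`;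
  the jumps satisfy `jump e' i = jump e i` resp. `jump e' i = jump e (−i−2)`; the windows of
  `AE, DtE, DE` are symmetric and the two windows of `BE`, `VE` swap;
* `lms_continuousOn_LE` (registered) — `e ↦ LE e m` is continuous on the normal-form data: it is the
  root layer-cake functional of `Continuity.lms_continuousOn_rootEnergyData` evaluated at the
  re-rooted data `rerootData e m` (`rootEnergyData_rerootData`), which depend continuously on `e`
  and stay normal;
* `lms_AB_bounds` (registered) — `|LE e m|, |AE n e|, |BE n e| ≤ K` on normal-form data, one `K`
  (a continuous function on the compact set of normal data, `isCompact_setOf_isNormalData`).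

All `[folklore]`.
-/

noncomputable section

open MeasureTheory Filter Set
open scoped BigOperators Topology

namespace Summit.AtomisticToContinuum.Crystallization.Theorems.SlackRigidityPricedFloorsIncrIdent

open Literature.MathematicalPhysics.StatisticalMechanics
open Summit.AtomisticToContinuum.Crystallization.Theorems.SlackRigidityPricedFloors
open Summit.AtomisticToContinuum.Crystallization.Theorems.LayeredHull

/-! ## The layer sum under the data relation -/

/-- Negating the word does not change the layer sum (it only uses label differences, and `Φ` is even
in the offset). [folklore] -/
theorem layerSum_negWord (a : ℝ) (s : ℤ → ℤ) (z : ℤ → ℝ) (m : ℤ) :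
    (∑' m' : ℤ, if m' = m then (0 : ℝ) else layerInteraction lennardJones a (z m' - z m)
      (haggLabel (fun k => -s k) m' - haggLabel (fun k => -s k) m) 1) =
    ∑' m' : ℤ, if m' = m then (0 : ℝ) else layerInteraction lennardJones a (z m' - z m)
      (haggLabel s m' - haggLabel s m) 1 := by
  -- labels of the negated word (`= CLayerWitnessWitness.haggLabel_neg`, kept local to avoid the import)
  have haggLabel_neg' : ∀ k : ℤ, haggLabel (fun m => -s m) k = -haggLabel s k := by
    intro k
    have hw : ∀ (m : ℤ) (j : ℕ), haggWindow (fun i => -s i) m j = -haggWindow s m j := by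
      intro m j
      simp [haggWindow, Finset.sum_neg_distrib]
    unfold haggLabel
    split_ifs <;> simp [hw]
  refine tsum_congr fun m' => ?_
  split_ifs with h
  · rfl
  · rw [haggLabel_neg', haggLabel_neg', neg_sub_neg, ← neg_sub (haggLabel s m') (haggLabel s m),
      layerInteraction_neg_offset]

/-- Reversing heights and word maps the layer-`m` sum to the layer-`(−m)` sum. [folklore] -/
theorem layerSum_reverse (a : ℝ) (s : ℤ → ℤ) (z : ℤ → ℝ) (m : ℤ) :
    (∑' m' : ℤ, if m' = m then (0 : ℝ) else layerInteraction lennardJones a (-z (-m') - -z (-m))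
      (haggLabel (fun k => s (-k - 1)) m' - haggLabel (fun k => s (-k - 1)) m) 1) =
    ∑' m' : ℤ, if m' = -m then (0 : ℝ) else layerInteraction lennardJones a (z m' - z (-m))
      (haggLabel s m' - haggLabel s (-m)) 1 := by
  -- labels of the reversed word (`= PrestressSplitKorn.haggLabel_reflect`, kept local to avoid the import);
  -- adapted from SlackRigidityPricedFloorsLayerEnergy.reverse_fits
  have haggLabel_reverse : ∀ m : ℤ, haggLabel (fun k => s (-k - 1)) m = -haggLabel s (-m) := by
    intro m
    induction m using Int.induction_on with
    | zero => simp
    | succ n ih =>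
      rw [haggLabel_succ, ih]
      have h := haggLabel_succ s (-((n : ℤ) + 1))
      rw [show -((n : ℤ) + 1) + 1 = -(n : ℤ) by ring] at h
      rw [h]
      ring_nf
    | pred n ih =>
      have h1 := haggLabel_succ (fun k => s (-k - 1)) (-(n : ℤ) - 1)
      rw [show -(n : ℤ) - 1 + 1 = -(n : ℤ) by ring] at h1
      have h2 := haggLabel_succ s (n : ℤ)
      rw [show -(-(n : ℤ) - 1) = (n : ℤ) + 1 by ring]
      have : haggLabel (fun k => s (-k - 1)) (-(n : ℤ) - 1) =
          haggLabel (fun k => s (-k - 1)) (-(n : ℤ)) - s (-(-(n : ℤ) - 1) - 1) := by linarith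
      rw [this, ih, h2, show -(-(n : ℤ) - 1) - 1 = (n : ℤ) by ring]
      ring
  rw [← Equiv.tsum_eq (Equiv.neg ℤ)]
  refine tsum_congr fun m' => ?_
  simp only [Equiv.neg_apply, neg_neg, haggLabel_reverse]
  by_cases h : m' = -m
  · rw [if_pos h, if_pos (by rw [h, neg_neg])]
  · rw [if_neg h, if_neg (fun h' => h (by rw [← h', neg_neg]))]
    rw [show -z m' - -z (-m) = -(z m' - z (-m)) by ring, SlackRigidityPricedFloorsContinuity.layerInteraction_neg_height,
      neg_sub_neg, ← neg_sub (haggLabel s m') (haggLabel s (-m)), layerInteraction_neg_offset]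

/-- Reversing heights and word (with a global sign flip of the word) maps the layer-`m` sum to the
layer-`(−m)` sum. [folklore] -/
theorem layerSum_reverse_neg (a : ℝ) (s : ℤ → ℤ) (z : ℤ → ℝ) (m : ℤ) :
    (∑' m' : ℤ, if m' = m then (0 : ℝ) else layerInteraction lennardJones a (-z (-m') - -z (-m))
      (haggLabel (fun k => -s (-k - 1)) m' - haggLabel (fun k => -s (-k - 1)) m) 1) =
    ∑' m' : ℤ, if m' = -m then (0 : ℝ) else layerInteraction lennardJones a (z m' - z (-m))
      (haggLabel s m' - haggLabel s (-m)) 1 := by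
  rw [← layerSum_reverse a s z m]
  exact layerSum_negWord a (fun k => s (-k - 1)) (fun k => -z (-k)) m

/-! ## Re-indexing of symmetric windows -/

/-- Reflection of a symmetric integer window. [folklore] -/
theorem sum_Icc_symm_reflect (f : ℤ → ℝ) (N : ℕ) :
    ∑ m ∈ Finset.Icc (-(N : ℤ)) N, f (-m) = ∑ m ∈ Finset.Icc (-(N : ℤ)) N, f m := by
  refine Finset.sum_equiv (Equiv.neg ℤ) (fun m => ?_) (fun m _ => rfl)
  simp only [Finset.mem_Icc, Equiv.neg_apply]
  omega

/-! ## (REL) Presentation invariance of the five functionals -/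

/-- **Invariance under the data relation** (registered sub-goal `lms_functionals_rel`): the window
functionals `AE, BE, VE, DtE` (every `n`) and `DE` take the same values on `REL`-related data.
[folklore] -/
theorem lms_functionals_rel : ∀ (e e' : LData), (e'.2.1 = e.2.1 ∧ ((e'.2.2.2 = e.2.2.2 ∧ (e'.2.2.1 = e.2.2.1 ∨ e'.2.2.1 = fun m => -e.2.2.1 m)) ∨ (e'.2.2.2 = (fun m => -e.2.2.2 (-m)) ∧ (e'.2.2.1 = (fun m => e.2.2.1 (-m - 1)) ∨ e'.2.2.1 = fun m => -e.2.2.1 (-m - 1))))) → (∀ n : ℕ, ((1 / (2 * (n : ℝ) + 1)) * ∑ m ∈ Finset.Icc (-(n : ℤ)) n, (inLayerInteraction lennardJones e'.2.1 + ∑' m' : ℤ, if m' = m then (0 : ℝ) else layerInteraction lennardJones e'.2.1 (e'.2.2.2 m' - e'.2.2.2 m) (haggLabel e'.2.2.1 m' - haggLabel e'.2.2.1 m) 1)) = ((1 / (2 * (n : ℝ) + 1)) * ∑ m ∈ Finset.Icc (-(n : ℤ)) n, (inLayerInteraction lennardJones e.2.1 + ∑' m' : ℤ, if m' = m then (0 :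 ℝ) else layerInteraction lennardJones e.2.1 (e.2.2.2 m' - e.2.2.2 m) (haggLabel e.2.2.1 m' - haggLabel e.2.2.1 m) 1)) ∧ (∑ m ∈ Finset.Icc (-((n + 1 : ℕ) : ℤ)) ((n + 1 : ℕ) : ℤ), ((1 / (2 * (2 * (n : ℝ) + 1))) * ((if m ∈ Finset.Icc (-(n : ℤ) + 1) ((n : ℤ) + 1) then (1 : ℝ) else 0) + (if m ∈ Finset.Icc (-(n : ℤ) - 1) ((n : ℤ) - 1) then (1 : ℝ) else 0))) * (inLayerInteraction lennardJones e'.2.1 + ∑' m' : ℤ, if m' = m then (0 : ℝ) else layerInteraction lennardJones e'.2.1 (e'.2.2.2 m' - e'.2.2.2 m) (haggLabel e'.2.2.1 m' - haggLabel e'.2.2.1 m) 1)) = (∑ m ∈ Finset.Icc (-((n + 1 : ℕ) : ℤ)) ((n + 1 : ℕ) : ℤ), ((1 / (2 * (2 * (n : ℝ) + 1))) * ((if m ∈ Finset.Icc (-(n : ℤ) + 1) ((n : ℤ) + 1) then (1 : ℝ) else 0) + (if m ∈ Finset.Icc (-(n : ℤ) - 1) ((n : ℤ) - 1) then (1 :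 ℝ) else 0))) * (inLayerInteraction lennardJones e.2.1 + ∑' m' : ℤ, if m' = m then (0 : ℝ) else layerInteraction lennardJones e.2.1 (e.2.2.2 m' - e.2.2.2 m) (haggLabel e.2.2.1 m' - haggLabel e.2.2.1 m) 1)) ∧ ((1 / (2 * (n : ℝ) + 1)) * (∑ l ∈ Finset.range (2 * n), ((e'.2.2.2 ((-(n : ℤ) + l) + 1) - e'.2.2.2 (-(n : ℤ) + l)) - (e'.2.2.2 ((-(n : ℤ) + l) + 2) - e'.2.2.2 ((-(n : ℤ) + l) + 1))) ^ 2 + ∑ l ∈ Finset.range (2 * n), ((e'.2.2.2 ((-(n : ℤ) - 1 + l) + 1) - e'.2.2.2 (-(n : ℤ) - 1 + l)) - (e'.2.2.2 ((-(n : ℤ) - 1 + l) + 2) - e'.2.2.2 ((-(n : ℤ) - 1 + l) + 1))) ^ 2)) = ((1 / (2 * (n : ℝ) + 1)) * (∑ l ∈ Finset.range (2 * n), ((e.2.2.2 ((-(n : ℤ) + l) + 1) - e.2.2.2 (-(n : ℤ) + l)) - (e.2.2.2 ((-(n : ℤ) + l) + 2) - e.2.2.2 ((-(n : ℤ) + l)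 + 1))) ^ 2 + ∑ l ∈ Finset.range (2 * n), ((e.2.2.2 ((-(n : ℤ) - 1 + l) + 1) - e.2.2.2 (-(n : ℤ) - 1 + l)) - (e.2.2.2 ((-(n : ℤ) - 1 + l) + 2) - e.2.2.2 ((-(n : ℤ) - 1 + l) + 1))) ^ 2)) ∧ ((1 / (2 * (n : ℝ) + 1)) * ∑ m ∈ Finset.Icc (-(n : ℤ)) n, (((e'.2.2.2 (m + 1) - e'.2.2.2 m) - (e'.2.2.2 (m + 2) - e'.2.2.2 (m + 1))) ^ 2 + ((e'.2.2.2 (m - 1) - e'.2.2.2 (m - 2)) - (e'.2.2.2 m - e'.2.2.2 (m - 1))) ^ 2)) = ((1 / (2 * (n : ℝ) + 1)) * ∑ m ∈ Finset.Icc (-(n : ℤ)) n, (((e.2.2.2 (m + 1) - e.2.2.2 m) - (e.2.2.2 (m + 2) - e.2.2.2 (m + 1))) ^ 2 + ((e.2.2.2 (m - 1) - e.2.2.2 (m - 2)) - (e.2.2.2 m - e.2.2.2 (m - 1))) ^ 2))) ∧ ((e'.2.2.2 1 - e'.2.2.2 0) - (e'.2.2.2 2 - e'.2.2.2 1)) ^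 2 + ((e'.2.2.2 (-1) - e'.2.2.2 (-2)) - (e'.2.2.2 0 - e'.2.2.2 (-1))) ^ 2 = ((e.2.2.2 1 - e.2.2.2 0) - (e.2.2.2 2 - e.2.2.2 1)) ^ 2 + ((e.2.2.2 (-1) - e.2.2.2 (-2)) - (e.2.2.2 0 - e.2.2.2 (-1))) ^ 2 := by
  rintro ⟨T, a, s, z⟩ ⟨T', a', s', z'⟩ h
  simp only at h
  obtain ⟨rfl, ⟨rfl, rfl | rfl⟩ | ⟨rfl, rfl | rfl⟩⟩ := h
  · exact ⟨fun n => ⟨rfl, rfl, rfl, rfl⟩, rfl⟩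
  · refine ⟨fun n => ⟨?_, ?_, rfl, rfl⟩, rfl⟩
    · simp only [layerSum_negWord]
    · simp only [layerSum_negWord]
  · refine ⟨fun n => ⟨?_, ?_, ?_, ?_⟩, ?_⟩
    · simp only [layerSum_reverse]
      congr 1
      conv_rhs => rw [← sum_Icc_symm_reflect _ n]
    · simp only [layerSum_reverse]
      obtain ⟨-, hsym, -, -⟩ := shiftCoeff_props n
      rw [← sum_Icc_symm_reflect _ (n + 1)]
      refine Finset.sum_congr rfl fun m _ => ?_
      rw [hsym m, neg_neg]
    · simp only
      rw [add_comm (∑ l ∈ Finset.range (2 * n), _)]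
      congr 2 <;>
      · refine Finset.sum_nbij' (fun l => 2 * n - 1 - l) (fun l => 2 * n - 1 - l) (fun l hl => ?_)
          (fun l hl => ?_) (fun l hl => ?_) (fun l hl => ?_) (fun l hl => ?_)
        · simp only [Finset.mem_range] at hl ⊢; omega
        · simp only [Finset.mem_range] at hl ⊢; omega
        · simp only [Finset.mem_range] at hl; omega
        · simp only [Finset.mem_range] at hl; omega
        · simp only [Finset.mem_range] at hl
          have e1 : ((2 * n - 1 - l : ℕ) : ℤ) = 2 * (n : ℤ) - 1 - l := by omega
          rw [e1]
          ring_nf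
    · simp only
      congr 1
      rw [← sum_Icc_symm_reflect _ n]
      refine Finset.sum_congr rfl fun m _ => ?_
      ring_nf
    · simp only [neg_neg, neg_zero]
      ring
  · refine ⟨fun n => ⟨?_, ?_, ?_, ?_⟩, ?_⟩
    · simp only [layerSum_reverse_neg]
      congr 1
      conv_rhs => rw [← sum_Icc_symm_reflect _ n]
    · simp only [layerSum_reverse_neg]
      obtain ⟨-, hsym, -, -⟩ := shiftCoeff_props n
      rw [← sum_Icc_symm_reflect _ (n + 1)]
      refine Finset.sum_congr rfl fun m _ => ?_
      rw [hsym m, neg_neg]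
    · simp only
      rw [add_comm (∑ l ∈ Finset.range (2 * n), _)]
      congr 2 <;>
      · refine Finset.sum_nbij' (fun l => 2 * n - 1 - l) (fun l => 2 * n - 1 - l) (fun l hl => ?_)
          (fun l hl => ?_) (fun l hl => ?_) (fun l hl => ?_) (fun l hl => ?_)
        · simp only [Finset.mem_range] at hl ⊢; omega
        · simp only [Finset.mem_range] at hl ⊢; omega
        · simp only [Finset.mem_range] at hl; omega
        · simp only [Finset.mem_range] at hl; omega
        · simp only [Finset.mem_range] at hl
          have e1 : ((2 * n - 1 - l : ℕ) : ℤ) = 2 * (n : ℤ) - 1 - l := by omega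
          rw [e1]
          ring_nf
    · simp only
      congr 1
      rw [← sum_Icc_symm_reflect _ n]
      refine Finset.sum_congr rfl fun m _ => ?_
      ring_nf
    · simp only [neg_neg, neg_zero]
      ring

/-! ## Continuity of the layer energies on the normal-form data -/

/-- **The layer-`k` energy is the root layer-cake functional of the re-rooted data.** [folklore] -/
theorem rootEnergyData_rerootData (e : LData) (k : ℤ) : (inLayerInteraction lennardJones (rerootData e k).2.1 + ∑' m : ℤ, if m = 0 then (0 : ℝ) else layerInteraction lennardJones (rerootData e k).2.1 ((rerootData e k).2.2.2 m) (haggLabel (rerootData e k).2.2.1 m) 1) = (inLayerInteraction lennardJones e.2.1 + ∑' m' : ℤ, if m' = k then (0 : ℝ) else layerInteraction lennardJones e.2.1 (e.2.2.2 m' - e.2.2.2 k) (haggLabel e.2.2.1 m' - haggLabel e.2.2.1 k) 1) := by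
  -- adapted from SlackRigidityPricedFloorsLayerEnergy.two_mul_rootEnergy_reroot (second half)
  obtain ⟨T, a, s, z⟩ := e
  simp only [rerootData]
  congr 1
  rw [← Equiv.tsum_eq (Equiv.subRight k)]
  refine tsum_congr fun m' => ?_
  simp only [Equiv.subRight_apply, sub_eq_zero, sub_add_cancel, ext_haggLabel_shift]

/-- Normal data lie in the continuity domain of `Continuity.lms_continuousOn_rootEnergyData`.
[folklore] -/
theorem normal_subset_domain : {e : LData | IsNormalData e} ⊆
    {e : LData | 47 / 50 ≤ e.2.1 ∧ e.2.1 ≤ 1 ∧ (∀ m : ℤ, 39 / 50 * e.2.1 ≤ e.2.2.2 (m + 1) - e.2.2.2 m ∧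
      e.2.2.2 (m + 1) - e.2.2.2 m ≤ 17 / 20 * e.2.1) ∧ e.2.2.2 0 = 0} :=
  fun _ he => ⟨he.2.1.1, he.2.1.2.1, he.2.1.2.2.2, he.2.2⟩

/-- Re-rooting is continuous in the data. [folklore] -/
theorem continuous_rerootData (m : ℤ) : Continuous fun e : LData => rerootData e m := by
  unfold rerootData
  fun_prop

/-- **Continuity of the layer energies** (registered sub-goal `lms_continuousOn_LE`): for every
`m`, `e ↦ LE e m` is continuous on the normal-form data. [folklore] -/
theorem lms_continuousOn_LE : ∀ (m : ℤ), ContinuousOn (fun e : LData => (inLayerInteraction lennardJones e.2.1 + ∑' m' : ℤ, if m' = m then (0 : ℝ) else layerInteraction lennardJones e.2.1 (e.2.2.2 m' - e.2.2.2 m) (haggLabel e.2.2.1 m' - haggLabel e.2.2.1 m) 1)) {e : LData | IsNormalData e} := by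
  intro m
  have h := (SlackRigidityPricedFloorsContinuity.lms_continuousOn_rootEnergyData.mono
    normal_subset_domain).comp (continuous_rerootData m).continuousOn
    (fun e he => isNormalData_rerootData he m)
  refine h.congr fun e _ => ?_
  simp only [Function.comp_apply]
  exact (rootEnergyData_rerootData e m).symm

/-! ## Bounds -/

/-- **Uniform bounds** (registered sub-goal `lms_AB_bounds`): one constant `K` bounds `|LE e m|`,
`|AE n e|` and `|BE n e|` over all normal-form data, layers `m` and window sizes `n`. [folklore] -/
theorem lms_AB_bounds : ∃ K : ℝ, 0 ≤ K ∧ ∀ (n : ℕ) (e : LData), IsNormalData e → (∀ m : ℤ, |(inLayerInteraction lennardJones e.2.1 + ∑' m' : ℤ, if m' = m then (0 : ℝ) else layerInteraction lennardJones e.2.1 (e.2.2.2 m' - e.2.2.2 m) (haggLabel e.2.2.1 m' - haggLabel e.2.2.1 m) 1)| ≤ K) ∧ |((1 / (2 * (n : ℝ) + 1)) * ∑ m ∈ Finset.Icc (-(n : ℤ)) n, (inLayerInteraction lennardJones e.2.1 + ∑' m' : ℤ, if m' = m then (0 : ℝ) else layerInteraction lennardJones e.2.1 (e.2.2.2 m'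 - e.2.2.2 m) (haggLabel e.2.2.1 m' - haggLabel e.2.2.1 m) 1))| ≤ K ∧ |(∑ m ∈ Finset.Icc (-((n + 1 : ℕ) : ℤ)) ((n + 1 : ℕ) : ℤ), ((1 / (2 * (2 * (n : ℝ) + 1))) * ((if m ∈ Finset.Icc (-(n : ℤ) + 1) ((n : ℤ) + 1) then (1 : ℝ) else 0) + (if m ∈ Finset.Icc (-(n : ℤ) - 1) ((n : ℤ) - 1) then (1 : ℝ) else 0))) * (inLayerInteraction lennardJones e.2.1 + ∑' m' : ℤ, if m' = m then (0 : ℝ) else layerInteraction lennardJones e.2.1 (e.2.2.2 m' - e.2.2.2 m) (haggLabel e.2.2.1 m' - haggLabel e.2.2.1 m) 1))| ≤ K := by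
  obtain ⟨K, hK⟩ := SlackRigidityPricedFloorsMeasurability.isCompact_setOf_isNormalData.exists_bound_of_continuousOn
    (SlackRigidityPricedFloorsContinuity.lms_continuousOn_rootEnergyData.mono normal_subset_domain)
  have hK0 : 0 ≤ K := by
    obtain ⟨e₀, he₀⟩ : ∃ e₀ : LData, IsNormalData e₀ :=
      ⟨((LinearIsometry.id : E3 →ₗᵢ[ℝ] E3).toContinuousLinearMap, 1, alternatingHagg, fun m => (4 / 5 : ℝ) * m),
        ⟨fun v => rfl, ⟨by norm_num, le_rfl, isHaggSeq_alternating, fun m => by push_cast; constructor <;> nlinarith⟩,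
          by simp⟩⟩
    exact (norm_nonneg _).trans (hK e₀ he₀)
  have hLE : ∀ e : LData, IsNormalData e → ∀ m : ℤ, |(inLayerInteraction lennardJones e.2.1 + ∑' m' : ℤ, if m' = m then (0 : ℝ) else layerInteraction lennardJones e.2.1 (e.2.2.2 m' - e.2.2.2 m) (haggLabel e.2.2.1 m' - haggLabel e.2.2.1 m) 1)| ≤ K := by
    intro e he m
    rw [← rootEnergyData_rerootData e m, ← Real.norm_eq_abs]
    exact hK _ (isNormalData_rerootData he m)
  refine ⟨K, hK0, fun n e he => ⟨hLE e he, ?_, ?_⟩⟩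
  · have ht : (0 : ℝ) < 2 * (n : ℝ) + 1 := by positivity
    rw [abs_mul, abs_of_pos (by positivity : (0 : ℝ) < 1 / (2 * (n : ℝ) + 1)), one_div_mul_eq_div,
      div_le_iff₀ ht]
    refine (Finset.abs_sum_le_sum_abs _ _).trans ?_
    refine (Finset.sum_le_sum fun m _ => hLE e he m).trans ?_
    rw [Finset.sum_const, nsmul_eq_mul, card_Icc_neg_nat]
    linarith
  · obtain ⟨hc0, -, -, hc1⟩ := shiftCoeff_props n
    refine (Finset.abs_sum_le_sum_abs _ _).trans ?_
    calc _ ≤ ∑ m ∈ Finset.Icc (-((n + 1 : ℕ) : ℤ)) ((n + 1 : ℕ) : ℤ), ((1 / (2 * (2 * (n : ℝ) + 1))) * ((if m ∈ Finset.Icc (-(n : ℤ) + 1) ((n : ℤ) + 1) then (1 : ℝ) else 0) + (if m ∈ Finset.Icc (-(n : ℤ) - 1) ((n : ℤ) - 1) then (1 : ℝ) else 0))) * K := by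
          refine Finset.sum_le_sum fun m _ => ?_
          rw [abs_mul, abs_of_nonneg (hc0 m)]
          exact mul_le_mul_of_nonneg_left (hLE e he m) (hc0 m)
      _ = K := by rw [← Finset.sum_mul, hc1, one_mul]

end Summit.AtomisticToContinuum.Crystallization.Theorems.SlackRigidityPricedFloorsIncrIdent

end
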